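import Literature.AlgebraicGeometry.Frobenioids.ArithmeticFrobenioidThm64ivSchema
import Literature.AlgebraicGeometry.Frobenioids.ArithmeticRealificationFrobeniusTrivial
import Literature.AlgebraicGeometry.Frobenioids.ArithmeticRealificationInstanceDelta
import Literature.AlgebraicGeometry.Frobenioids.ArithmeticFrobenioidThm64ivNormPreservation
import Literature.AlgebraicGeometry.Frobenioids.ArithmeticFrobenioidThm64iiFunctorForm
import Literature.AlgebraicGeometry.Frobenioids.ArithmeticFrobenioidThm64iiiBinders
import Literature.AlgebraicGeometry.Frobenioids.ArithmeticFrobenioidDivisorTransportDegree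
import Literature.AlgebraicGeometry.Frobenioids.Cor54SubTransportProofs
import Literature.AlgebraicGeometry.Frobenioids.Cor54SubRealSpanCompatProofs
import Literature.AlgebraicGeometry.Frobenioids.Prop53SubProofs
import Literature.AlgebraicGeometry.Frobenioids.MonoidFunctorsOnD
import HarnessLib

/-!
# Frobenioids I, Theorem 6.4 (iii) — the typed schema `Thm64iii` AT THE CONSTRUCTIONS in the situation of (iv)
# (`Ψ^rlf` induced by an equivalence `Ψ : C_{K₁/F₁} ⥲ C_{K₂/F₂}` of arithmetic Frobenioids; row «T64-ASSEMBLIES»)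

Mochizuki, *The geometry of Frobenioids I: the general theory*, Kyushu J. Math. **62** (2008) 293–400, §6,
Thm. 6.4 (iii), kurims text pp. 114–115 ("Then `deg(Ψ^rlf) ∈ ℚ_{>0}` … the bijection
`V(L₁) ⥲ Prime(Φ₁(L₁)) ⥲ Prime(Φ₂(L₂)) ⥲ V(L₂)` … maps a valuation lying over `v₀ ∈ V(ℚ)` to a valuation lying over
`v₀`"), proof p. 116 l. 4–16; (iv) p. 115 l. 17–19 ("If the equivalence of categories `Ψ^rlf` of (ii) arises from an
equivalence of categories `Ψ : C₁ ⥲ C₂` [cf. (i); (iii); Theorem 3.4, (iii), (iv)] …").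
[cite: MochizukiFrdI2008, Thm. 6.4 (iii) p.114]

PROOF-ONLY composition (cell abc-iut, `plan/L1/SUBDAG-FrdI-Thm64.md`; L1-lead R114 (2) / R124 «GO assemble T64iii at
the data»; seat abc-iut-L1-t3 = the typer of the schema `Thm64iii`; 0 `def`, no instance, no notation, no named fact).
Over the [FrdI] Cor. 4.11 (iv) DATUM of an equivalence `Ψ : C_{K₁/F₁} ⥲ C_{K₂/F₂}` as BINDERS (`Ψ^Base` a functor
that is an equivalence, `E = Ψ^Φ` over it, `η`, the `Div`-clause — delivered binder-free by abc-iut-L1-d7's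
`exists_transport_of_cor411iv` from the typed Cor. 4.11 (iv), which HOLDS at `C_{K/F}`: abc-iut-L1-d1's
`cor411iv_arith`), everything else is at THE data and consumed BY NAME:
* THE realified transport `Ψ^rlf : C₁^rlf ⥲ C₂^rlf`, built here EXPLICITLY as the model-data functor of
  abc-iut-w5-d137's `FrdI.Cor54Sub.rlfDataHomOver` (`(A, α) ↦ (Ψ^Base A, (Ψ^Φ)^rlf α)`, so that `Base(Ψ^rlf A) =
  Ψ^Base(Base A)` ON THE NOSE — the argument of `FrdI.Cor54Sub.rlfTransport_holds`), over `(Ψ^Φ)^rlf =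
  FrdI.Cor54Sub.rlfIso … E` with the real spans respected (abc-iut-L1-d7's `arith_biratCompat_of_cor411iv` +
  abc-iut-w5-d097's `realSpanCompat_holds`);
* [FrdI] Thm. 6.4 (ii) AT THE DATA — abc-iut-w4-d086's `ArithFrd.exists_picMap_thm64ii_functor` (THE induced `picMap`
  with `Thm64ii`, and `picMap` on classes of monoid elements);
* THE realifications `arithRealification hΦ_i` with `δ_A[ι D] = deg^arith(D)` (abc-iut-L1-d2's
  `arithRealification_δ_mk_iota`), the Frobenius-trivial objects `(X, 0)` and their preservation
  (abc-iut-L1-t3's `ArithmeticRealificationFrobeniusTrivial.lean`);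
* abc-iut-L1-d1's adapter `exists_deg_divisorTransport_of_datum` (ONE `deg₀ > 0` with the divisor-level degree clause
  of `Ψ^Φ`) and abc-iut-L1-d9's `EffArithDivisor.thm64iii_of_divMulEquiv` (⇒ THE place bijection `placeMap` induced by
  `Ψ^Φ_X`, with its prime-support transport) and `thm64iii_of_divTransport` (the schema letter from the divisor-level
  iso `e = Ψ^Φ_X`, `he`, and the degree clause `hed`) — where `hed` for the schema's OWN `deg` is derived here from the
  `Thm64iiDeg` antecedent through the readings of `picMap` / `δ` on classes of `ι D` (so the antecedent pins `deg`).

RESULT `Thm64iii_arith_of_datum`: in the letter of the schema, with `U_i := C_i^rlf`, `u_i := 𝟭`, `Ψ' := Ψ^rlf`,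
`A₁ := (X, 0)` — the instance of (iii) that (iv) invokes ("arises from `Ψ` … cf. (iii)") — for every `X = Spec L₁`:
`Thm64iii R₁ R₂ Ψrlf picMap deg (𝟭 _) (𝟭 _) Ψrlf (X, 0) placeMap` for EVERY `deg` (THE degree is pinned by the
`Thm64iiDeg` antecedent; here it is in fact `1`, `Thm64iv_degOne_of_datum`).  HONEST SCOPE: print's (iii) is stated
for an equivalence `(Ψ^pf)^un-tr` of the unit-trivialised perfections, a WEAKER hypothesis than (iv)'s; the
instance over THOSE categories (`U_i = (C_i^pf)^un-tr`, `u_i` = the comparison functors of Prop. 5.5) needs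
[FrdI] Cor. 4.11 (iii) at the unit-trivialised perfections, which is not in the tree — this file does not claim it.
Nothing here bears on, or takes a side on, [IUTchIII] Cor. 3.12; no statement of the paper is strengthened.
-/

noncomputable section

open scoped NNReal

namespace Literature.AlgebraicGeometry.Frobenioids

open CategoryTheory Opposite Function NumberField Literature.AnabelianGeometry.EtaleTheta
open EffArithDivisor (psupp)

section AtData

variable {F₁ : Type} [Field F₁] [NumberField F₁] {K₁ : Type} [Field K₁] [Algebra F₁ K₁] [IsGalois F₁ K₁]
  {F₂ : Type} [Field F₂] [NumberField F₂] {K₂ : Type} [Field K₂] [Algebra F₂ K₂] [IsGalois F₂ K₂]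
  (hΦ₁ : PreFrobenioid.IsPerfFactorialOn (arithDivisorFunctor F₁ K₁))
  (hΦ₂ : PreFrobenioid.IsPerfFactorialOn (arithDivisorFunctor F₂ K₂))
  (Ψ : arithFrobenioid F₁ K₁ ≌ arithFrobenioid F₂ K₂)
  (ΨBase : FinSubextCat F₁ K₁ ⥤ FinSubextCat F₂ K₂) [ΨBase.IsEquivalence]
  (E : (arithFrobenioidOps F₁ K₁).DivisorMonoidIsoOverBase (arithFrobenioidOps F₂ K₂) ΨBase)
  (η : Ψ.functor ⋙ (arithFrobenioidOps F₂ K₂).base ≅ (arithFrobenioidOps F₁ K₁).base ⋙ ΨBase)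
  (hdiv : ∀ ⦃A B : arithFrobenioid F₁ K₁⦄ (φ : A ⟶ B),
    (arithFrobenioidOps F₂ K₂).div (Ψ.functor.map φ) =
      (arithFrobenioidOps F₂ K₂).pull (η.hom.app A)
        (E.iso ((arithFrobenioidOps F₁ K₁).base.obj A) ((arithFrobenioidOps F₁ K₁).div φ)))

include η hdiv in
/-- **(iii) at the data — THE place bijections induced by `Ψ^Φ`, with print's three conclusions, field-level form.**
For the Cor. 4.11 (iv) datum of `Ψ : C_{K₁/F₁} ⥲ C_{K₂/F₂}` there is ONE `deg₀ ∈ ℚ_{>0}` (THE degree of `Ψ^rlf` read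
through `ι`, abc-iut-L1-d1) and, for every `X = Spec L₁`, a bijection `V(L₁) ≃ V(L₂)`, `L₂ = (Ψ^Base X).L`, transporting
prime supports along `Ψ^Φ_X`, archimedean to archimedean, finite to finite over the same rational prime
(abc-iut-L1-d9's `thm64iii_of_divMulEquiv`: commensurability, Lem. 6.5). [cite: MochizukiFrdI2008, Thm. 6.4 (iii) p.115] -/
theorem exists_deg_placeMaps_of_datum :
    ∃ deg₀ : ℝ, (∃ q : ℚ, 0 < q ∧ deg₀ = q) ∧
      (∀ (X : FinSubextCat F₁ K₁) (D : EffArithDivisor X.L),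
        arithDegree (ΨBase.obj X).L (EffArithDivisor.toArithDivisor _
            (Multiplicative.toAdd (E.iso X (Multiplicative.ofAdd D)))) =
          deg₀ * arithDegree X.L (EffArithDivisor.toArithDivisor _ D)) ∧
      ∀ X : FinSubextCat F₁ K₁, ∃ π : Places X.L ≃ Places (ΨBase.obj X).L,
        (∀ v : Places X.L,
            psupp (Multiplicative.toAdd (E.iso X (Multiplicative.ofAdd (EffArithDivisor.single X.L v)))) = {π v}) ∧
        (∀ u : InfinitePlace X.L, ∃ u' : InfinitePlace (ΨBase.obj X).L, π (Sum.inl u) = Sum.inl u') ∧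
        ∀ w : FinitePlace X.L, ∃ w' : FinitePlace (ΨBase.obj X).L,
          π (Sum.inr w) = Sum.inr w' ∧ residueChar w = residueChar w' := by
  obtain ⟨deg₀, hpos, hdeg⟩ := exists_deg_divisorTransport_of_datum Ψ ΨBase E η hdiv
  have hX := fun X : FinSubextCat F₁ K₁ =>
    thm64iii_of_divMulEquiv X.L (ΨBase.obj X).L deg₀ hpos (E.iso X) (hdeg X)
  obtain ⟨X₀⟩ : Nonempty (FinSubextCat F₁ K₁) := ⟨⟨⊥⟩⟩
  refine ⟨deg₀, (hX X₀).choose_spec.2.1, hdeg, fun X => ?_⟩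
  obtain ⟨π, hπ, -, hinf, hfin⟩ := hX X
  exact ⟨π, hπ, hinf, hfin⟩

include η hdiv in
/-- **[FrdI] Theorem 6.4 (iii) AS TYPED (`Thm64iii`), AT THE CONSTRUCTIONS, in the situation of (iv).**  For the
Cor. 4.11 (iv) datum of an equivalence `Ψ : C_{K₁/F₁} ⥲ C_{K₂/F₂}`: THE induced equivalence `Ψ^rlf : C₁^rlf ⥲ C₂^rlf`
(lying over `Ψ^Base` on the nose), THE induced `picMap` (satisfying Thm. 6.4 (ii), `Thm64ii`), and for every
`X = Spec L₁` THE place bijection `placeMap` induced by `Ψ^Φ_X`, such that — reading the schema with `U_i := C_i^rlf`,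
`u_i := 𝟭`, `Ψ' := Ψ^rlf`, `A₁ := (X, 0)` — `Thm64iii R₁ R₂ Ψrlf picMap deg 𝟭 𝟭 Ψrlf (X, 0) placeMap` holds for EVERY
`deg` (`R_i = arithRealification hΦ_i`): granted `Thm64iiDeg … deg`, `deg ∈ ℚ_{>0}` and `placeMap` respects the type
of places and residue characteristics. [cite: MochizukiFrdI2008, Thm. 6.4 (iii) p.114] -/
theorem Thm64iii_arith_of_datum :
    ∃ (Ψrlf : PreFrobenioid.rlf (ModelFrobenioid.toElem (arithDivisorFunctor F₁ K₁) (unitsFunctor F₁ K₁)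
          (divNatTrans F₁ K₁)) hΦ₁ ≌
        PreFrobenioid.rlf (ModelFrobenioid.toElem (arithDivisorFunctor F₂ K₂) (unitsFunctor F₂ K₂)
          (divNatTrans F₂ K₂)) hΦ₂)
      (picMap : ∀ A, (arithRealification hΦ₁).Pic A ≃+ (arithRealification hΦ₂).Pic (Ψrlf.functor.obj A)),
      (∀ A, (arithRealification hΦ₂).ops.base.obj (Ψrlf.functor.obj A) =
        ΨBase.obj ((arithRealification hΦ₁).ops.base.obj A)) ∧
      Thm64ii (arithRealification hΦ₁) (arithRealification hΦ₂) Ψrlf picMap ∧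
      ∀ X : FinSubextCat F₁ K₁,
        ∃ placeMap : Places ((arithRealification hΦ₁).ops.base.obj
              (⟨X, 1⟩ : PreFrobenioid.rlf (ModelFrobenioid.toElem (arithDivisorFunctor F₁ K₁) (unitsFunctor F₁ K₁)
                (divNatTrans F₁ K₁)) hΦ₁)).L ≃
            Places ((arithRealification hΦ₂).ops.base.obj (Ψrlf.functor.obj ⟨X, 1⟩)).L,
          ∀ deg : ℝ,
            Thm64iii (arithRealification hΦ₁) (arithRealification hΦ₂) Ψrlf picMap deg (𝟭 _) (𝟭 _) Ψrlf ⟨X, 1⟩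
              placeMap := by
  -- Cor. 5.4: `(Ψ^Φ)^rlf`, the real spans
  let Erlf : PreFrobenioidData.DivisorMonoidIsoOverBase
      (FrdI.Cor54Sub.rlfData (ModelFrobenioid.toElem (arithDivisorFunctor F₁ K₁) (unitsFunctor F₁ K₁)
        (divNatTrans F₁ K₁)) hΦ₁)
      (FrdI.Cor54Sub.rlfData (ModelFrobenioid.toElem (arithDivisorFunctor F₂ K₂) (unitsFunctor F₂ K₂)
        (divNatTrans F₂ K₂)) hΦ₂) ΨBase :=
    FrdI.Cor54Sub.rlfIso
      (ModelFrobenioid.toElem (arithDivisorFunctor F₁ K₁) (unitsFunctor F₁ K₁) (divNatTrans F₁ K₁)) hΦ₁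
      (ModelFrobenioid.toElem (arithDivisorFunctor F₂ K₂) (unitsFunctor F₂ K₂) (divNatTrans F₂ K₂)) hΦ₂ E
  have hBC := arith_biratCompat_of_cor411iv Ψ E η hdiv
  have hover := FrdI.Cor54Sub.rlfIso_toRlf
    (ModelFrobenioid.toElem (arithDivisorFunctor F₁ K₁) (unitsFunctor F₁ K₁) (divNatTrans F₁ K₁)) hΦ₁
    (ModelFrobenioid.toElem (arithDivisorFunctor F₂ K₂) (unitsFunctor F₂ K₂) (divNatTrans F₂ K₂)) hΦ₂ E
  have hspan := FrdI.Cor54Sub.realSpanCompat_holds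
    (ModelFrobenioid.toElem (arithDivisorFunctor F₁ K₁) (unitsFunctor F₁ K₁) (divNatTrans F₁ K₁)) hΦ₁
    (ModelFrobenioid.toElem (arithDivisorFunctor F₂ K₂) (unitsFunctor F₂ K₂) (divNatTrans F₂ K₂)) hΦ₂ E Erlf hBC hover
  -- THE `Ψ^rlf`, explicitly: the model-data functor of `rlfDataHomOver` (base `= Ψ^Base ∘ Base` on the nose)
  let h := FrdI.Cor54Sub.rlfDataHomOver hΦ₁ hΦ₂ ΨBase Erlf hspan
  have hηb : ∀ X : FinSubextCat F₁ K₁, Bijective (h.η.app (op X)).hom := fun X => (Erlf.iso X).bijective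
  have hβb : ∀ X : FinSubextCat F₁ K₁, Bijective (h.β.app (op X)).hom := by
    intro X
    have hgp : Bijective (gpApp (FrdI.Cor54Sub.rlfNatTransOver hΦ₁ hΦ₂ ΨBase Erlf) (op X)) :=
      gpMap_bijective_of_bijective _ (Erlf.iso X).bijective
    refine ⟨fun a b hab => Subtype.ext (hgp.1 (congrArg Subtype.val hab)), fun ⟨y, hy⟩ => ?_⟩
    have hy' : y ∈ ((RealificationData.canonical (arithDivisorFunctor F₂ K₂)
        (PreFrobenioid.IsPerfFactorialOn.op hΦ₂)).realSpan (PreFrobenioid.biratSubfunctor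
          (ModelFrobenioid.toElem (arithDivisorFunctor F₂ K₂) (unitsFunctor F₂ K₂) (divNatTrans F₂ K₂)))).carrier
        (ΨBase.obj X) := hy
    rw [← hspan X] at hy'
    obtain ⟨x, hx, hxy⟩ := Subgroup.mem_map.mp hy'
    exact ⟨⟨x, hx⟩, Subtype.ext hxy⟩
  haveI : h.functor.IsEquivalence := h.functor_isEquivalence hηb hβb
  let ηrlf : h.functor ⋙ (FrdI.Cor54Sub.rlfData (ModelFrobenioid.toElem (arithDivisorFunctor F₂ K₂) (unitsFunctor F₂ K₂)
      (divNatTrans F₂ K₂)) hΦ₂).base ≅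
    (FrdI.Cor54Sub.rlfData (ModelFrobenioid.toElem (arithDivisorFunctor F₁ K₁) (unitsFunctor F₁ K₁)
      (divNatTrans F₁ K₁)) hΦ₁).base ⋙ ΨBase :=
    NatIso.ofComponents (fun A => Iso.refl (ΨBase.obj A.base)) (fun φ => by
      change ΨBase.map (ModelFrobenioid.baseMap φ) ≫ 𝟙 _ = 𝟙 _ ≫ ΨBase.map _
      rw [Category.comp_id, Category.id_comp]
      rfl)
  have hdeg' : ∀ ⦃A B⦄ (φ : A ⟶ B), (arithRealification hΦ₂).ops.degFr (h.functor.map φ) =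
      (arithRealification hΦ₁).ops.degFr φ := fun A B φ => rfl
  have hdiv' : ∀ ⦃A B⦄ (φ : A ⟶ B), (arithRealification hΦ₂).ops.div (h.functor.map φ) =
      (arithRealification hΦ₂).ops.pull (ηrlf.hom.app A)
        (Erlf.iso ((arithRealification hΦ₁).ops.base.obj A) ((arithRealification hΦ₁).ops.div φ)) := by
    intro A B φ
    change Erlf.iso A.base (ModelFrobenioid.div φ) =
      (FrdI.Cor54Sub.rlfData (ModelFrobenioid.toElem (arithDivisorFunctor F₂ K₂) (unitsFunctor F₂ K₂)
        (divNatTrans F₂ K₂)) hΦ₂).pull (𝟙 (ΨBase.obj A.base)) (Erlf.iso A.base (ModelFrobenioid.div φ))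
    rw [(FrdI.Cor54Sub.rlfData (ModelFrobenioid.toElem (arithDivisorFunctor F₂ K₂) (unitsFunctor F₂ K₂)
      (divNatTrans F₂ K₂)) hΦ₂).pull_id]
  -- Thm. 6.4 (ii) at the data: THE picMap (functor form), with the reading of `δ ∘ picMap` on classes
  obtain ⟨picMap, hT, -, hδ₂⟩ :=
    ArithFrd.exists_picMap_thm64ii_functor hΦ₁ hΦ₂ h.functor.asEquivalence ΨBase ηrlf Erlf hspan
  -- THE place bijections
  obtain ⟨deg₀, -, -, hplaces⟩ := exists_deg_placeMaps_of_datum Ψ ΨBase E η hdiv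
  refine ⟨h.functor.asEquivalence, picMap, fun A => rfl, hT, fun X => ?_⟩
  obtain ⟨placeMap, hsupp, -, -⟩ := hplaces X
  -- the Frobenius-trivial object `(X, 0)` and its image
  have hA : (arithRealification hΦ₁).ops.IsFrobeniusTrivial
      (⟨X, 1⟩ : PreFrobenioid.rlf
        (ModelFrobenioid.toElem (arithDivisorFunctor F₁ K₁) (unitsFunctor F₁ K₁) (divNatTrans F₁ K₁)) hΦ₁) :=
    arithRealification_isFrobeniusTrivial_zero hΦ₁ X
  have hA' : (arithRealification hΦ₂).ops.IsFrobeniusTrivial (h.functor.asEquivalence.functor.obj ⟨X, 1⟩) :=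
    arithRealification_isFrobeniusTrivial_map hΦ₁ hΦ₂ ΨBase Erlf h.functor ηrlf hdeg' hdiv' hA
  refine ⟨placeMap, fun deg hTdeg hcomm => ?_⟩
  -- the degree clause `hed` for THIS `deg`, from the `Thm64iiDeg` antecedent read on the classes `[ι D]`
  have hed : ∀ D : EffArithDivisor X.L,
      arithDegree (ΨBase.obj X).L (EffArithDivisor.toArithDivisor _
          (Multiplicative.toAdd (E.iso X (Multiplicative.ofAdd D)))) =
        deg * arithDegree X.L (EffArithDivisor.toArithDivisor _ D) := by
    intro D
    -- `δ₂(picMap [ι D]) = δ at Ψ^Base X of [(Ψ^Φ)^rlf (ι D)]`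
    have h3 : (arithRealification hΦ₂).δ _ hA' (picMap ⟨X, 1⟩ (Additive.ofMul (QuotientGroup.mk' _
        (Algebra.GrothendieckGroup.of ((PreFrobenioid.IsPerfFactorialOn.op hΦ₁ (op X)).toRealification
          (Perfection.of _ (Multiplicative.ofAdd D))))))) =
      Multiplicative.toAdd (ArithRlfPic.picDegree hΦ₂ (ΨBase.obj X) (QuotientGroup.mk' _
        (Algebra.GrothendieckGroup.of (Erlf.iso X ((PreFrobenioid.IsPerfFactorialOn.op hΦ₁ (op X)).toRealification
          (Perfection.of _ (Multiplicative.ofAdd D))))))) :=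
      hδ₂ ⟨X, 1⟩ hA' _
    -- `(Ψ^Φ)^rlf (ι D) = ι (Ψ^Φ D)`
    have h6 : Erlf.iso X ((PreFrobenioid.IsPerfFactorialOn.op hΦ₁ (op X)).toRealification
          (Perfection.of _ (Multiplicative.ofAdd D))) =
        (PreFrobenioid.IsPerfFactorialOn.op hΦ₂ (op (ΨBase.obj X))).toRealification
          (Perfection.of _ (E.iso X (Multiplicative.ofAdd D))) := hover X (Multiplicative.ofAdd D)
    rw [h6] at h3
    -- `δ₂ ∘ picMap = deg · δ₁` (the antecedent) and `δ₁[ι D] = deg^arith D`, `δ[ι D'] = deg^arith D'`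
    have h4 := hTdeg.2 ⟨X, 1⟩ hA hA' (Additive.ofMul (QuotientGroup.mk' _
      (Algebra.GrothendieckGroup.of ((PreFrobenioid.IsPerfFactorialOn.op hΦ₁ (op X)).toRealification
        (Perfection.of _ (Multiplicative.ofAdd D))))))
    have h5 := arithRealification_δ_mk_iota hΦ₁ ⟨X, 1⟩ hA D
    have h7 : ArithRlfPic.picDegree hΦ₂ (ΨBase.obj X) (QuotientGroup.mk' _
        (Algebra.GrothendieckGroup.of ((PreFrobenioid.IsPerfFactorialOn.op hΦ₂ (op (ΨBase.obj X))).toRealification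
          (Perfection.of _ (E.iso X (Multiplicative.ofAdd D)))))) =
        Multiplicative.ofAdd (arithDegree (ΨBase.obj X).L (EffArithDivisor.toArithDivisor _
          (Multiplicative.toAdd (E.iso X (Multiplicative.ofAdd D))))) :=
      ArithRlfPic.picDegree_mk_iota hΦ₂ (ΨBase.obj X) (Multiplicative.toAdd (E.iso X (Multiplicative.ofAdd D)))
    rw [h4, h5] at h3
    rw [h7, toAdd_ofAdd] at h3
    exact h3.symm
  exact thm64iii_of_divTransport (arithRealification hΦ₁) (arithRealification hΦ₂) h.functor.asEquivalence picMap
    deg (𝟭 _) (𝟭 _) h.functor.asEquivalence ⟨X, 1⟩ placeMap (E.iso X) hsupp hed hTdeg hcomm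

end AtData

end Literature.AlgebraicGeometry.Frobenioids

end
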